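import Summits.BirchSwinnertonDyer.Rank1Residual.Additive.X4RankZeroSemistableTwistOddSurj
import Summits.BirchSwinnertonDyer.Rank1Residual.Additive.X4RankZeroSemistableTwistEven
import HarnessLib

/-!
# X4 ∧ `r_an = 0` ∧ (semistable twist by `p*`), ANY odd `p`: one statement for both parities, image hypothesis = census bits of `E` (cell `b2b-bsdres`, seat additive-p4, line V9b)

HONEST FRAMING (cell `b2b-bsdres`, run/shared/lean/b2b/bsd-rank1-residual/, verbatim in every
file): the goal of the cell is to DELETE the COMBINATION-SHAPED residual classes of the
Birch–Swinnerton-Dyer formula for ALL analytic-rank `≤ 1` elliptic curves over `ℚ` — "full BSD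
formula for every rank `≤ 1` curve in class `C`" assembled STRICTLY from published theorems — so
that the rank-`≤ 1` remainder becomes exactly the CONSTRUCTION-SHAPED classes, which are TYPED
(missing-input `Prop`s), NOT attempted. This is not "finishing BSD". The additive sub-cell (seats
additive-p1…p4) is a RESEARCH ROUTE on the construction-shaped classes X3/X4; no claim beyond the
stated classes; the label of X4 is UNCHANGED.

Theorems only (no definition, no named fact). X4 twin of `X3RankZeroSemistableTwistAnyOdd.lean`
(p204799): glues the odd assembly (`X4RankZeroTwistOdd.*_of_surj` / `*_of_surj_of_ram`,
`X4RankZeroSemistableTwistOddSurj.lean`) and the even one (`X4RankZeroTwistEven.*_of_surj`,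
`X4RankZeroSemistableTwistEven.lean`) into ONE statement per odd prime, for Partition / class
consumers: on X4 ∧ `r_an = 0` with `W = C • V^{(p*)}`, `p* = (−1)^{⌊p/2⌋} p`, `V` globally minimal
good ordinary or multiplicative at `p`, `f` its newform, rational `ϖ⁺, ϖ⁻` (`ϖ⁺·Ω_V = Ω⁺_f`,
`ϖ⁻·|Ω⁻(V)| = Ω⁻_f`), image hypothesis **`surj(p)` of `E`, plus `ram(p)` when `p = 3`**, granted the
Kato-shaped typed inputs of BOTH parities (only the relevant one is used):

* `X4RankZeroTwist.missingUpperBoundAt_of_odd_prime_of_surj` — `Typed.MissingUpperBoundAt W p`;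
* `X4RankZeroTwist.bsdp_of_odd_prime_of_surj_of_shaAn_unit` — `BSD(E,p)` on the `p ∤ #Ш_an` rows;
* `X4RankZeroTwist.missingPPartAt_iff_lower_of_odd_prime_of_surj` — what remains is the LOWER half.

References: [Kato2004Asterisque] Thm. 17.4; [Delbourgo1998] Prop. 4; [SerreAbelianLadic1968] IV
§3.4; [BurungaleSkinnerTianWan2024] (ram); [Miller2011LMS] Def. 1.1.
-/

noncomputable section

open scoped Classical MatrixGroups ModularForm

open CongruenceSubgroup WeierstrassCurve Literature.NumberTheory.EllipticCurves
  Literature.NumberTheory.EllipticCurves.ModularForms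
  Literature.NumberTheory.EllipticCurves.Rank1Residual

namespace Summit.BirchSwinnertonDyer.Rank1Residual.Additive

section AnyOddX4

open IsDedekindDomain NumberField Rat.HeightOneSpectrum
  Literature.NumberTheory.EllipticCurves.Rank1Residual.Typed

variable (W : WeierstrassCurve ℚ) [W.IsElliptic] [W.IsGloballyMinimal] (p : ℕ) [hp : Fact p.Prime]

/-- **V9b for every odd prime (both parities glued).** On X4 ∧ `r_an = 0` with
`W = C • V^{(p*)}`, `p* = (−1)^{⌊p/2⌋} p`, `V` globally minimal good ordinary or multiplicative at
the odd prime `p`, `ρ̄_{E,p}` surjective, and `ram(p)` for `E` when `p = 3` (for `p ≥ 5` Serre's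
lemma makes it unnecessary): **`Typed.MissingUpperBoundAt W p`** (`ord_p #Ш(E) ≤ ord_p #Ш_an(E)`),
granted the typed inputs `ChiBranchLeadingTermBigImageAt W p` (used when `p ≡ 1 (mod 4)`) and
`ChiBranchLeadingTermOddBigImageAt W p` (used when `p ≡ 3 (mod 4)`); other inputs: Delbourgo 1998
Prop. 4 (`hDel`), GZK (`hGZK`), modularity (`hmod`), tree theorems. -/
theorem X4RankZeroTwist.missingUpperBoundAt_of_odd_prime_of_surj
    (hDel : Delbourgo1998.prop4_rankZero_pow_dvd_constantCoeff)
    (hGZK : rank_eq_analyticRank_of_analyticRank_le_one) (hmod : hasEntireLFunction_rat)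
    (hBCeven : ChiBranchLeadingTermBigImageAt W p) (hBCodd : ChiBranchLeadingTermOddBigImageAt W p)
    (hp2 : p ≠ 2) (hr : W.analyticRank = 0) (hX : ClassX4 W p) (hsurj : Surj W p)
    (hram3 : p = 3 → Ram W p)
    (V : WeierstrassCurve ℚ) [V.IsElliptic] [V.IsGloballyMinimal]
    (C : VariableChange ℚ) (hC : C • V.quadraticTwist ((-1 : ℚ) ^ (p / 2) * p) = W)
    (hV : GoodOrd V p ∨ Mult V p)
    {N : ℕ} [NeZero N] {f : CuspForm (Gamma0 N) 2} (hf : IsNewformOf V f)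
    (ϖp : ℚ) (hϖp : (ϖp : ℝ) * V.realPeriodRat = plusPeriod f)
    (ϖm : ℚ) (hϖm : (ϖm : ℝ) * V.imaginaryPeriodRat = minusPeriod f) :
    MissingUpperBoundAt W p := by
  have hodd : p % 4 = 1 ∨ p % 4 = 3 := by
    obtain ⟨k, hk⟩ := hp.out.odd_of_ne_two hp2
    omega
  rcases hodd with h1 | h3
  · have hC' : C • V.quadraticTwist (p : ℚ) = W := by
      rw [pStar_eq_of_mod_four p (Or.inl h1), if_pos h1] at hC
      exact hC
    exact X4RankZeroTwistEven.missingUpperBoundAt_of_surj W p hDel hGZK hmod hBCeven h1 hr hX hsurj V C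
      hC' hV hf ϖp hϖp
  · have hC' : C • V.quadraticTwist (-(p : ℚ)) = W := by
      rw [pStar_eq_of_mod_four p (Or.inr h3), if_neg (by omega)] at hC
      exact hC
    by_cases hp3 : p = 3
    · exact X4RankZeroTwistOdd.missingUpperBoundAt_of_surj_of_ram W p hDel hGZK hmod hBCodd h3 hr hX
        hsurj (hram3 hp3) V C hC' hV hf ϖm hϖm
    · exact X4RankZeroTwistOdd.missingUpperBoundAt_of_surj W p hDel hGZK hmod hBCodd h3 hp3 hr hX hsurj
        V C hC' hV hf ϖm hϖm

/-- **`BSD(E,p)` for every odd prime on the `p ∤ #Ш_an(E)` rows** of X4 ∧ `r_an = 0` ∧ (semistable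
twist by `p*`) ∧ `surj(p)` (∧ `ram(3)` if `p = 3`), granted the typed inputs. -/
theorem X4RankZeroTwist.bsdp_of_odd_prime_of_surj_of_shaAn_unit
    (hDel : Delbourgo1998.prop4_rankZero_pow_dvd_constantCoeff)
    (hGZK : rank_eq_analyticRank_of_analyticRank_le_one) (hmod : hasEntireLFunction_rat)
    (hBCeven : ChiBranchLeadingTermBigImageAt W p) (hBCodd : ChiBranchLeadingTermOddBigImageAt W p)
    (hp2 : p ≠ 2) (hr : W.analyticRank = 0) (hX : ClassX4 W p) (hsurj : Surj W p)
    (hram3 : p = 3 → Ram W p)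
    (V : WeierstrassCurve ℚ) [V.IsElliptic] [V.IsGloballyMinimal]
    (C : VariableChange ℚ) (hC : C • V.quadraticTwist ((-1 : ℚ) ^ (p / 2) * p) = W)
    (hV : GoodOrd V p ∨ Mult V p)
    {N : ℕ} [NeZero N] {f : CuspForm (Gamma0 N) 2} (hf : IsNewformOf V f)
    (ϖp : ℚ) (hϖp : (ϖp : ℝ) * V.realPeriodRat = plusPeriod f)
    (ϖm : ℚ) (hϖm : (ϖm : ℝ) * V.imaginaryPeriodRat = minusPeriod f)
    {q : ℚ} (hq : shaAn W = (q : ℂ)) (hv : padicValRat p q = 0) : BSDp W p :=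
  bsdp_of_missingPPartAt W p hGZK (by rw [hr]; exact zero_le_one)
    (missingPPartAt_of_upper_of_shaAn_unit W p
      (X4RankZeroTwist.missingUpperBoundAt_of_odd_prime_of_surj W p hDel hGZK hmod hBCeven hBCodd hp2
        hr hX hsurj hram3 V C hC hV hf ϖp hϖp ϖm hϖm) hq hv)

/-- **What remains of X4♯ on these pairs is exactly the LOWER half**, for every odd prime, granted
the typed inputs: `Typed.X4.MissingInputAt W p ⟺ MissingLowerBoundAt W p`. -/
theorem X4RankZeroTwist.missingPPartAt_iff_lower_of_odd_prime_of_surj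
    (hDel : Delbourgo1998.prop4_rankZero_pow_dvd_constantCoeff)
    (hGZK : rank_eq_analyticRank_of_analyticRank_le_one) (hmod : hasEntireLFunction_rat)
    (hBCeven : ChiBranchLeadingTermBigImageAt W p) (hBCodd : ChiBranchLeadingTermOddBigImageAt W p)
    (hp2 : p ≠ 2) (hr : W.analyticRank = 0) (hX : ClassX4 W p) (hsurj : Surj W p)
    (hram3 : p = 3 → Ram W p)
    (V : WeierstrassCurve ℚ) [V.IsElliptic] [V.IsGloballyMinimal]
    (C : VariableChange ℚ) (hC : C • V.quadraticTwist ((-1 : ℚ) ^ (p / 2) * p) = W)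
    (hV : GoodOrd V p ∨ Mult V p)
    {N : ℕ} [NeZero N] {f : CuspForm (Gamma0 N) 2} (hf : IsNewformOf V f)
    (ϖp : ℚ) (hϖp : (ϖp : ℝ) * V.realPeriodRat = plusPeriod f)
    (ϖm : ℚ) (hϖm : (ϖm : ℝ) * V.imaginaryPeriodRat = minusPeriod f) :
    X4.MissingInputAt W p ↔ MissingLowerBoundAt W p :=
  ⟨fun h ↦ (lower_and_upper_of_missingPPartAt W p h).1, fun h ↦
    missingPPartAt_of_lower_of_upper W p h
      (X4RankZeroTwist.missingUpperBoundAt_of_odd_prime_of_surj W p hDel hGZK hmod hBCeven hBCodd hp2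
        hr hX hsurj hram3 V C hC hV hf ϖp hϖp ϖm hϖm)⟩

end AnyOddX4

end Summit.BirchSwinnertonDyer.Rank1Residual.Additive

end
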